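import Literature.Geometry.Riemannian.MetricFlowConcentration
import Literature.Geometry.Riemannian.MetricFlow
import HarnessLib

/-!
# Continuity of a metric flow at a time; past and future continuity (Bamler 2023, §4.3, Def. 4.?)

R. Bamler, *Compactness theory of the space of super Ricci flows*, Invent. Math. 233 (2023), §4.3,
Definition (arXiv v1 Def. 83): "We say that `𝒳` is continuous at time `t₀ ∈ I` if for all
conjugate heat flows `(μ_t)_{t ∈ I'}` that satisfy `t₀ ∈ I' ⊂ I`, `Var(μ_t) < ∞` for all `t ∈ I'`,
the function `t ↦ ∫_{𝒳_t} ∫_{𝒳_t} d_t dμ_t dμ_t` is continuous at `t₀`. We say that `𝒳` is past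
continuous at time `t₀` if `𝒳_{≤ t₀}` is continuous at time `t₀` and future continuous at time
`t₀` if `𝒳_{≥ t₀}` is continuous at time `t₀`. The metric flow `𝒳` is called (past/future)
continuous if the same is true at all times `t₀ ∈ I`."

We define the average distance of a measure on a time-slice (`MetricFlow.averageEDist`, the
`[0, ∞]`-valued double lower integral used throughout the tree's §4.2 files), continuity at a time
(`MetricFlow.IsContinuousAtTime`), future and past continuity at a time
(`IsFutureContinuousAtTime`, `IsPastContinuousAtTime` — conjugate heat flows over subsets of
`I ∩ [t₀, ∞)`, resp. `I ∩ (−∞, t₀]`, i.e. the conjugate heat flows of the restricted flow) and the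
global notions, and prove the immediate implication "continuous ⇒ future and past continuous"
(the source's Remark: continuity iff both). Future continuity is the property of the limits in the
𝔽-compactness theorem (§7, Thm. 7.6) and of future completions (§4.4).

## References

* R. H. Bamler, *Compactness theory of the space of super Ricci flows*, Invent. Math. 233 (2023),
  1121–1277, §4.3, Definition (continuity of a metric flow at a time) and the Remark following it.
  [Bamler2023]
-/

noncomputable section

open Set MeasureTheory Filter TopologicalSpace Function
open scoped Topology ENNReal NNReal

namespace Literature.Geometry.Riemannian

universe u

namespace MetricFlow

variable {I : Set ℝ} (𝒳 : MetricFlow.{u} I)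

/-- **Average distance of a measure on a time-slice**, `∫_{𝒳_t} ∫_{𝒳_t} d_t dμ dμ ∈ [0, ∞]`
(the function of Bamler 2023, §4.3, Definition (continuity), display; cf. §4.2 (4.4)).
[cite: Bamler2023, §4.3, Definition (continuity of a metric flow at a time)] -/
def averageEDist {t : I} (μ : Measure (𝒳.Slice t)) : ℝ≥0∞ :=
  ∫⁻ x, ∫⁻ y, edist x y ∂μ ∂μ

/-- Unfolding of the average distance. [cite: Bamler2023, §4.3, Definition (continuity of a metric flow at a time)] -/
theorem averageEDist_def {t : I} (μ : Measure (𝒳.Slice t)) :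
    𝒳.averageEDist μ = ∫⁻ x, ∫⁻ y, edist x y ∂μ ∂μ := rfl

/-- **Continuity of the metric flow at the time `t₀` relative to conjugate heat flows over
subsets of `S`**: for every conjugate heat flow `(μ_t)_{t ∈ I'}` with `t₀ ∈ I' ⊆ S` and
`Var(μ_t) < ∞` on `I'`, the average distance `t ↦ ∫∫ d_t dμ_t dμ_t` is continuous at `t₀` within
`I'`. With `S = I` this is continuity at `t₀`; with `S = I ∩ [t₀, ∞)` / `S = I ∩ (−∞, t₀]` it is
future / past continuity (the conjugate heat flows of `𝒳_{≥ t₀}` / `𝒳_{≤ t₀}` are exactly the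
conjugate heat flows of `𝒳` over subsets of these sets).
[cite: Bamler2023, §4.3, Definition (continuity of a metric flow at a time)] -/
def IsContinuousAtTimeRel (S : Set ℝ) (t₀ : I) : Prop :=
  ∀ ⦃I' : Set ℝ⦄, I' ⊆ S → (t₀ : ℝ) ∈ I' → ∀ μ : ∀ t : I, Measure (𝒳.Slice t),
    𝒳.IsConjugateHeatFlow I' μ → (∀ t : I, (t : ℝ) ∈ I' → variance (μ t) (μ t) < ∞) →
    ContinuousWithinAt (fun t : I ↦ 𝒳.averageEDist (μ t)) {t : I | (t : ℝ) ∈ I'} t₀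

/-- **`𝒳` is continuous at time `t₀`** (Bamler 2023, §4.3, Definition).
[cite: Bamler2023, §4.3, Definition (continuity of a metric flow at a time)] -/
def IsContinuousAtTime (t₀ : I) : Prop :=
  𝒳.IsContinuousAtTimeRel I t₀

/-- **`𝒳` is future continuous at time `t₀`**: `𝒳_{≥ t₀}` is continuous at `t₀`
(right-continuity of the average distance along conjugate heat flows living on `[t₀, ∞)`).
[cite: Bamler2023, §4.3, Definition (continuity of a metric flow at a time)] -/
def IsFutureContinuousAtTime (t₀ : I) : Prop :=
  𝒳.IsContinuousAtTimeRel (I ∩ Ici (t₀ : ℝ)) t₀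

/-- **`𝒳` is past continuous at time `t₀`**: `𝒳_{≤ t₀}` is continuous at `t₀`.
[cite: Bamler2023, §4.3, Definition (continuity of a metric flow at a time)] -/
def IsPastContinuousAtTime (t₀ : I) : Prop :=
  𝒳.IsContinuousAtTimeRel (I ∩ Iic (t₀ : ℝ)) t₀

/-- **`𝒳` is continuous** (at all times). [cite: Bamler2023, §4.3, Definition (continuity of a metric flow at a time)] -/
def IsContinuous (𝒳 : MetricFlow.{u} I) : Prop :=
  ∀ t₀ : I, 𝒳.IsContinuousAtTime t₀

/-- **`𝒳` is future continuous** (at all times) — the property of 𝔽-limits in the compactness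
theorem (§7, Thm. 7.6) and of future completions (§4.4).
[cite: Bamler2023, §4.3, Definition (continuity of a metric flow at a time)] -/
def IsFutureContinuous (𝒳 : MetricFlow.{u} I) : Prop :=
  ∀ t₀ : I, 𝒳.IsFutureContinuousAtTime t₀

/-- **`𝒳` is past continuous** (at all times). [cite: Bamler2023, §4.3, Definition (continuity of a metric flow at a time)] -/
def IsPastContinuous (𝒳 : MetricFlow.{u} I) : Prop :=
  ∀ t₀ : I, 𝒳.IsPastContinuousAtTime t₀

variable {𝒳}

/-- Continuity relative to `S` is antitone in `S` (fewer conjugate heat flows to test).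
[cite: Bamler2023, §4.3, Definition (continuity of a metric flow at a time)] -/
theorem IsContinuousAtTimeRel.anti {S S' : Set ℝ} {t₀ : I} (h : 𝒳.IsContinuousAtTimeRel S t₀)
    (hS : S' ⊆ S) : 𝒳.IsContinuousAtTimeRel S' t₀ :=
  fun _ hI' ht₀ μ hμ hvar ↦ h (hI'.trans hS) ht₀ μ hμ hvar

/-- **Continuous at `t₀` ⇒ future continuous at `t₀`** (the conjugate heat flows of `𝒳_{≥ t₀}`
are among those of `𝒳`; Bamler 2023, §4.3, Remark: "a flow is continuous at time `t₀` if and only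
if it is both past and future continuous" — the easy direction).
[cite: Bamler2023, §4.3, Remark after the Definition (continuity)] -/
theorem IsContinuousAtTime.isFutureContinuousAtTime {t₀ : I} (h : 𝒳.IsContinuousAtTime t₀) :
    𝒳.IsFutureContinuousAtTime t₀ :=
  IsContinuousAtTimeRel.anti h inter_subset_left

/-- **Continuous at `t₀` ⇒ past continuous at `t₀`.**
[cite: Bamler2023, §4.3, Remark after the Definition (continuity)] -/
theorem IsContinuousAtTime.isPastContinuousAtTime {t₀ : I} (h : 𝒳.IsContinuousAtTime t₀) :
    𝒳.IsPastContinuousAtTime t₀ :=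
  IsContinuousAtTimeRel.anti h inter_subset_left

/-- **Continuous ⇒ future continuous and past continuous.**
[cite: Bamler2023, §4.3, Remark after the Definition (continuity)] -/
theorem IsContinuous.isFutureContinuous_and_isPastContinuous (h : 𝒳.IsContinuous) :
    𝒳.IsFutureContinuous ∧ 𝒳.IsPastContinuous :=
  ⟨fun t₀ ↦ (h t₀).isFutureContinuousAtTime, fun t₀ ↦ (h t₀).isPastContinuousAtTime⟩

/-- **Continuous ⇒ future continuous and past continuous** (plain-named form).
[cite: Bamler2023, §4.3, Remark after the Definition (continuity)] -/
theorem isFutureContinuous_and_isPastContinuous (h : 𝒳.IsContinuous) :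
    𝒳.IsFutureContinuous ∧ 𝒳.IsPastContinuous :=
  h.isFutureContinuous_and_isPastContinuous

end MetricFlow

end Literature.Geometry.Riemannian

end
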